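import Summits.ResolutionOfSingularities.ResolutionOfSingularities.Theorems.EquisingularLiftEquisingularLiftNatLargeCharSpreadFibreWordPos
import Summits.ResolutionOfSingularities.ResolutionOfSingularities.Theorems.EquisingularLiftEquisingularLiftNatDescWordRegularBase
import HarnessLib

/-!
# EL♮(3) / EL♮(n), RUNG LC «large characteristic» — brick (B5) on `ℙⁿ`: THE POINT-WISE DOOR `DescDoorAt B k θ n H ι` over every regular Noetherian flat
# base `A → B` inverting some `a ≠ 0`, from the K-side word of an integral running transform on `ℙⁿ_K`

leafhand-res-equisingularlift-3 g0 (prover, 2026-08-31; one-generation line-first hand on stmt-ResolutionOfSingularities-20148 / -20038 /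
-15660, cell `pub/decomp-res`).  Crux `EquisingularLiftNatThree` (`stmt-…-20148`; uniform in `n`, so also `stmt-…-20038`), line W4.5(b), RUNG LC
(idea-2 g32 `Cruxes/EquisingularLiftNatThree/LARGE-CHAR-RUNG-idea2.md` v1.6 §(B5′) «the spread B-word ⇒ `DescDoorAt B k θ n H ι`»).  ASSEMBLY on `ℙⁿ` of this
hand's bricks: the model (✓ `CentreSeq.exists_comap_eq_of_isPullback_generic`), the spread of centre smoothness (✓ `CentreSeq.exists_forall_descCentresSmoothOver_comap`),
the full fibre word (✓ `CentreSeq.exists_forall_descTransformOK_comap_of_inv`, INV = ✓ `inv_of_eq` for the door's `σ = 𝟙`), the free `B`-flatness of the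
exceptional divisors over a regular base (✓ `CentreSeq.exceptionalFlatOver_of_descCentresSmoothOver`, ✓ `isRegular_proj_of_isRegular_Spec`) and the
flatness-free constructor ✓ `descDoorAt_of_smoothCentres`; squares ✓ `ProjBaseChangeRing.isPullback_projMap'`.  DEF-FREE:

* ★★★ `exists_forall_descDoorAt_of_K_word` — `A` a Noetherian domain with fraction field `K` of characteristic `0`, `n : ℕ`, a word `t_K : CentreSeq ℙⁿ_K`
  with `K`-smooth centres, an ideal sheaf `𝓣` on `ℙⁿ_A` whose generic fibre `V(𝓣_K)` is INTEGRAL, and the K-side certificate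
  `DescTransformOK t_K σ_K Y₀,K (supp 𝓣_K)` with GEN (e.g. ✓ `LargeChar.exists_centreSeq_descTransformOK` with `σ_K = 𝟙`, `Y₀,K = supp 𝓣_K`, GEN = ✓ `gen_of_eq`).
  THEN there are a model `s : CentreSeq ℙⁿ_A` of `t_K` and `a ≠ 0` such that for every NOETHERIAN FLAT `A`-algebra `B ∋ a⁻¹` with `Spec B` REGULAR (the (B4)
  base `A[1/(a a₀)]`), every field `k`, point `θ : B →+* k` and embedded `ι : H ⟶ ℙⁿ_k` TIED to `𝓣` («`range ι` is the `θ`-fibre of `supp 𝓣`» in every graded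
  lift square — the (c3) `Cut`), the point-wise door holds: `DescDoorAt B k θ n H ι`.

HONEST RESIDUAL of `hspread` after this file (R2′, bookkeeping + one dichotomy): (i) the K-side INPUTS for the universal degree-`d` hypersurface over
`A = ℤ[c]/𝔮` — the reduced equation of the generic member and the dichotomy «generic member geometrically integral, or no integral member over some `D(b)`»
(✓ `Limits/NonIntegralFibresSpread.exists_forall_not_isDomain_mvPolynomial`-type), then ✓ `LargeChar.exists_centreSeq_descTransformOK` (…StrongHypSelf) on the
reduced generic hypersurface; (ii) the (B4) shrink to a smooth `ℤ`-algebra (✓ `LargeChar.exists_formallySmooth_away_of_charZero`) + ✓ `descDoorAt_of_ringHom`;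
(iii) the N:=1 glue `DescDoorAt ⇒ DescDoorSharp` (lh2); (iv) the (c3) tying for the chosen `Cut` (preimage of `V₊(F)` under `Proj.map φ` = `V₊(φ F)`, ✓ `map_univHyp`);
(v) reading (i)–(iv) into the binder shape of `hspread` (the Noetherian induction itself is ✓ `largeChar_roof`).  EL♮(3) NOT proved; EL♮ NOT proved; resolution of
singularities in positive characteristic NOT proved; nothing of [Hironaka2017] (a candidate under adjudication) is asserted or used.  [OURS · assembly over tree
lemmas · standard axioms · DEF-FREE · `--supports stmt-ResolutionOfSingularities-20148 --as helper`, counted 0 · AI-written, weaker than expert review.]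
[cite: Grothendieck1966, EGA IV₃ §8–§9] [cite: Liu2002, Prop. 3.1.9 and Ex. 3.1.10] (method; index only)
-/

set_option linter.dupNamespace false -- mandated namespace `Summit.<Summit>.<Problem>` of this single-conjunct summit

noncomputable section

open CategoryTheory CategoryTheory.Limits AlgebraicGeometry TopologicalSpace Topology
open MvPolynomial
open Literature.AlgebraicGeometry.Resolution
open Literature.AlgebraicGeometry.Motives
open AlgebraicGeometry.Scheme.IdealSheafData

namespace Summit.ResolutionOfSingularities.ResolutionOfSingularities.Cruxes.EquisingularLiftNat.Sections

section Door

variable (A : Type) [CommRing A] [IsDomain A] [IsNoetherianRing A] (K : Type) [Field K] [CharZero K] [Algebra A K] [IsFractionRing A K] (n : ℕ)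

/-- ★★★ **The point-wise descent door over every regular Noetherian flat base inverting some `a ≠ 0`, from the K-side word** — see the module docstring.
[cite: Grothendieck1966, EGA IV₃ §8–§9] [cite: Liu2002, Prop. 3.1.9 and Ex. 3.1.10] [OURS · L1 W4.5b · RUNG LC (B5) assembly on `ℙⁿ`; EL♮(3) NOT proved] -/
theorem exists_forall_descDoorAt_of_K_word
    (tK : letI := MvPolynomial.gradedAlgebra (σ := Fin (n + 1)) (R := K)
      CentreSeq (Proj (homogeneousSubmodule (Fin (n + 1)) K)))
    (T : letI := MvPolynomial.gradedAlgebra (σ := Fin (n + 1)) (R := A)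
      (Proj (homogeneousSubmodule (Fin (n + 1)) A)).IdealSheafData)
    {PK : Scheme.{0}}
    (σK : letI := MvPolynomial.gradedAlgebra (σ := Fin (n + 1)) (R := K)
      Proj (homogeneousSubmodule (Fin (n + 1)) K) ⟶ PK) (Y₀K : Set PK)
    (hsmK : letI := MvPolynomial.gradedAlgebra (σ := Fin (n + 1)) (R := K)
      DescCentresSmoothOver tK
        (Proj.toSpecZero (homogeneousSubmodule (Fin (n + 1)) K) ≫
          Spec.map (CommRingCat.ofHom (algebraMap K (homogeneousSubmodule (Fin (n + 1)) K 0)))))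
    (hTK : letI := MvPolynomial.gradedAlgebra (σ := Fin (n + 1)) (R := A)
      letI := MvPolynomial.gradedAlgebra (σ := Fin (n + 1)) (R := K)
      DescTransformOK tK σK Y₀K
        (((T.comap (Proj.map (ProjBaseChangeRing.mapGraded A K (Fin (n + 1))) (ProjBaseChangeRing.irrelevant_le_map A K (Fin (n + 1))))).support :
          Set (Proj (homogeneousSubmodule (Fin (n + 1)) K)))))
    (hint : letI := MvPolynomial.gradedAlgebra (σ := Fin (n + 1)) (R := A)
      letI := MvPolynomial.gradedAlgebra (σ := Fin (n + 1)) (R := K)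
      IsIntegral (T.comap (Proj.map (ProjBaseChangeRing.mapGraded A K (Fin (n + 1))) (ProjBaseChangeRing.irrelevant_le_map A K (Fin (n + 1))))).subscheme)
    (hGEN : letI := MvPolynomial.gradedAlgebra (σ := Fin (n + 1)) (R := A)
      letI := MvPolynomial.gradedAlgebra (σ := Fin (n + 1)) (R := K)
      ∀ y, IsGenericPoint y
        (((T.comap (Proj.map (ProjBaseChangeRing.mapGraded A K (Fin (n + 1))) (ProjBaseChangeRing.irrelevant_le_map A K (Fin (n + 1))))).support :
          Set (Proj (homogeneousSubmodule (Fin (n + 1)) K)))) → IsGenericPoint (σK y) Y₀K) :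
    letI := MvPolynomial.gradedAlgebra (σ := Fin (n + 1)) (R := A)
    letI := MvPolynomial.gradedAlgebra (σ := Fin (n + 1)) (R := K)
    ∃ (s : CentreSeq (Proj (homogeneousSubmodule (Fin (n + 1)) A))) (a : A),
      s.comap (Proj.map (ProjBaseChangeRing.mapGraded A K (Fin (n + 1))) (ProjBaseChangeRing.irrelevant_le_map A K (Fin (n + 1)))) = tK ∧
      a ≠ 0 ∧
      ∀ (B : Type) [CommRing B] [IsNoetherianRing B] [Algebra A B] [Module.Flat A B], IsUnit (algebraMap A B a) →
        Scheme.IsRegular (Spec (.of B)) →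
        ∀ (k : Type) [Field k] (θ : B →+* k) (H : Scheme.{0}) (ι : H ⟶ (Literature.AlgebraicGeometry.Motives.projectiveSpace n k).left),
          letI := MvPolynomial.gradedAlgebra (σ := Fin (n + 1)) (R := B)
          letI := MvPolynomial.gradedAlgebra (σ := Fin (n + 1)) (R := k)
          (∀ (φ : homogeneousSubmodule (Fin (n + 1)) B →+*ᵍ homogeneousSubmodule (Fin (n + 1)) k)
              (hφ' : HomogeneousIdeal.irrelevant (homogeneousSubmodule (Fin (n + 1)) k) ≤
                (HomogeneousIdeal.irrelevant (homogeneousSubmodule (Fin (n + 1)) B)).map φ),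
              (∀ t, φ t = MvPolynomial.map θ t) →
              IsPullback (Proj.map φ hφ' :
                    (Literature.AlgebraicGeometry.Motives.projectiveSpace n k).left ⟶ Proj (homogeneousSubmodule (Fin (n + 1)) B))
                  (Proj.toSpecZero (homogeneousSubmodule (Fin (n + 1)) k) ≫
                    Spec.map (CommRingCat.ofHom (algebraMap k (homogeneousSubmodule (Fin (n + 1)) k 0))))
                  (Proj.toSpecZero (homogeneousSubmodule (Fin (n + 1)) B) ≫
                    Spec.map (CommRingCat.ofHom (algebraMap B (homogeneousSubmodule (Fin (n + 1)) B 0))))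
                  (Spec.map (CommRingCat.ofHom θ)) →
              Set.range ι =
                (((T.comap (Proj.map (ProjBaseChangeRing.mapGraded A B (Fin (n + 1))) (ProjBaseChangeRing.irrelevant_le_map A B (Fin (n + 1))))).comap
                    (Proj.map φ hφ' : (Literature.AlgebraicGeometry.Motives.projectiveSpace n k).left ⟶ Proj (homogeneousSubmodule (Fin (n + 1)) B))).support :
                  Set (Proj (homogeneousSubmodule (Fin (n + 1)) k)))) →
          DescDoorAt B k θ n H ι := by
  letI := MvPolynomial.gradedAlgebra (σ := Fin (n + 1)) (R := A)
  letI := MvPolynomial.gradedAlgebra (σ := Fin (n + 1)) (R := K)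
  -- the structure morphisms and the generic square
  set qA : Proj (homogeneousSubmodule (Fin (n + 1)) A) ⟶ Spec (.of A) :=
    Proj.toSpecZero (homogeneousSubmodule (Fin (n + 1)) A) ≫
      Spec.map (CommRingCat.ofHom (algebraMap A (homogeneousSubmodule (Fin (n + 1)) A 0))) with hqA
  set qK : Proj (homogeneousSubmodule (Fin (n + 1)) K) ⟶ Spec (.of K) :=
    Proj.toSpecZero (homogeneousSubmodule (Fin (n + 1)) K) ≫
      Spec.map (CommRingCat.ofHom (algebraMap K (homogeneousSubmodule (Fin (n + 1)) K 0))) with hqK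
  set jK : Proj (homogeneousSubmodule (Fin (n + 1)) K) ⟶ Proj (homogeneousSubmodule (Fin (n + 1)) A) :=
    Proj.map (ProjBaseChangeRing.mapGraded A K (Fin (n + 1))) (ProjBaseChangeRing.irrelevant_le_map A K (Fin (n + 1))) with hjK
  have HK : IsPullback jK qK qA (specOfAlgebra A K) := ProjBaseChangeRing.isPullback_projMap' A K
  obtain ⟨hsmA, hprA⟩ := Summit.ResolutionOfSingularities.ResolutionOfSingularities.Cruxes.EquisingularLift.StrataSplit.stub_projectiveAmbientSmoothProper A n
  obtain ⟨hsmK', -⟩ := Summit.ResolutionOfSingularities.ResolutionOfSingularities.Cruxes.EquisingularLift.StrataSplit.stub_projectiveAmbientSmoothProper K n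
  haveI := hsmA
  haveI := hprA
  haveI := hsmK'
  haveI : LocallyOfFiniteType qA := inferInstance
  haveI : QuasiCompact qA := inferInstance
  haveI : LocallyOfFiniteType qK := inferInstance
  haveI : IsLocallyNoetherian (Proj (homogeneousSubmodule (Fin (n + 1)) K)) := LocallyOfFiniteType.isLocallyNoetherian qK
  -- the model and the two spreads
  obtain ⟨s, hs⟩ := CentreSeq.exists_comap_eq_of_isPullback_generic K tK qA jK qK HK
  have hsm : DescCentresSmoothOver (s.comap jK) qK := by rw [hs]; exact hsmK
  have hT : DescTransformOK (s.comap jK) σK Y₀K (((T.comap jK).support : Set _)) := by rw [hs]; exact hTK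
  obtain ⟨a₁, ha₁, h₁⟩ := CentreSeq.exists_forall_descCentresSmoothOver_comap K s qA jK qK HK hsm
  obtain ⟨a₂, ha₂, h₂⟩ := CentreSeq.exists_forall_descTransformOK_comap_of_inv K s qA jK qK HK T σK Y₀K hsm hT hint hGEN
  refine ⟨s, a₁ * a₂, hs, mul_ne_zero ha₁ ha₂, fun B _ _ _ _ hunit hB k _ θ H ι htie => ?_⟩
  rw [map_mul] at hunit
  letI := MvPolynomial.gradedAlgebra (σ := Fin (n + 1)) (R := B)
  letI := MvPolynomial.gradedAlgebra (σ := Fin (n + 1)) (R := k)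
  -- the base-changed word on `ℙⁿ_B`: smooth centres, hence (regular base) flat exceptionals
  set qB : Proj (homogeneousSubmodule (Fin (n + 1)) B) ⟶ Spec (.of B) :=
    Proj.toSpecZero (homogeneousSubmodule (Fin (n + 1)) B) ≫
      Spec.map (CommRingCat.ofHom (algebraMap B (homogeneousSubmodule (Fin (n + 1)) B 0))) with hqB
  set GB : Proj (homogeneousSubmodule (Fin (n + 1)) B) ⟶ Proj (homogeneousSubmodule (Fin (n + 1)) A) :=
    Proj.map (ProjBaseChangeRing.mapGraded A B (Fin (n + 1))) (ProjBaseChangeRing.irrelevant_le_map A B (Fin (n + 1))) with hGB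
  have HB : IsPullback GB qB qA (specOfAlgebra A B) := ProjBaseChangeRing.isPullback_projMap' A B
  have hCS : DescCentresSmoothOver (s.comap GB) qB := h₁ B (isUnit_of_mul_isUnit_left hunit) _ _ HB
  obtain ⟨hnoethB, hregB⟩ := isRegular_proj_of_isRegular_Spec B hB n
  haveI := hnoethB
  have hEF : (s.comap GB).ExceptionalFlatOver qB := CentreSeq.exceptionalFlatOver_of_descCentresSmoothOver hB hregB _ qB hCS
  -- the door, clause by clause
  refine descDoorAt_of_smoothCentres B hB k θ n H ι (s.comap GB) hCS fun φ hφ' hφ hsq => ?_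
  letI : Algebra B k := θ.toAlgebra
  have hsq' : IsPullback (Proj.map φ hφ' :
        (Literature.AlgebraicGeometry.Motives.projectiveSpace n k).left ⟶ Proj (homogeneousSubmodule (Fin (n + 1)) B))
      (Proj.toSpecZero (homogeneousSubmodule (Fin (n + 1)) k) ≫
        Spec.map (CommRingCat.ofHom (algebraMap k (homogeneousSubmodule (Fin (n + 1)) k 0))))
      qB (specOfAlgebra B k) := hsq
  have hY := htie φ hφ' hφ hsq
  have hword := h₂ B (isUnit_of_mul_isUnit_right hunit) GB qB HB hEF k (Proj.map φ hφ') _ hsq'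
    (𝟙 (Literature.AlgebraicGeometry.Motives.projectiveSpace n k).left) (Set.range ι)
    (by rw [hY]; exact inv_of_eq _)
  rw [← hY] at hword
  exact hword

end Door

end Summit.ResolutionOfSingularities.ResolutionOfSingularities.Cruxes.EquisingularLiftNat.Sections

end
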